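import Literature.NumberTheory.EllipticCurves.HasseWeilAbelianEulerFactorForallProofs
import Literature.NumberTheory.EllipticCurves.TateModuleGaloisTransportProofs
import Literature.NumberTheory.EllipticCurves.QuadraticBaseChangeGaloisProofs
import Literature.NumberTheory.GaloisRepresentations.CoinvariantsQuadraticTwistRamified
import Literature.NumberTheory.Automorphic.ReciprocityGLnDescentProofs
import HarnessLib

/-!
# Artin formalism for a quadratic base change, one place at a time:
# `L_w(E_K, T)`, `L_p(E, T)`, `L_p(E^{(d_K)}, T)` for Mathlib's local polynomials

`Proofs` file (theorems only) in topic `NumberTheory/EllipticCurves`, the local heart of the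
discharge of the named fact `WeierstrassCurve.LSeries_baseChange_quadratic` (Ireland–Rosen,
*A Classical Introduction to Modern Number Theory*, 2nd ed., Prop. 20.5.4(b):
`L(E/K, s) = L(E/ℚ, s) L(E_D/ℚ, s)` for a quadratic field `K` of discriminant `D`; the printed text
gives no proof: "it is not too hard to prove").  For an elliptic curve `W/ℚ`, a quadratic number
field `K` with `D = d_K`, the twist `W^{(D)} = W.quadraticTwist D`, a place `v` of `ℚ` and a place
`w ∣ v` of `K`, `WeierstrassCurve.localPolynomialAt_baseChange_quadratic` proves, for Mathlib's
local polynomials `L = WeierstrassCurve.localPolynomialAt` (`localPolynomial` of the base change to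
the completion, on a minimal model):

* `e(w|v) = f(w|v) = 1` (split): `L_w(W_K) = L_v(W)` and `L_v(W^{(D)}) = L_v(W)`;
* `e(w|v) = 1`, `f(w|v) = 2` (inert): `expand 2 (L_w(W_K)) = L_v(W) · L_v(W^{(D)})`
  (i.e. `L_w(W_K, T²) = L_v(W, T) L_v(W^{(D)}, T)`);
* `w` the only place above `v` and `f(w|v) = 1` (ramified): `L_w(W_K) = L_v(W) · L_v(W^{(D)})`.

Proof (the Galois-theoretic one, valid at every prime including those of additive reduction):
choose a prime `ℓ` with `v ∤ ℓ`; all three local polynomials are reversed characteristic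
polynomials of Frobenius on inertia coinvariants of `ℓ`-adic Tate modules
(`reverse_charpoly_toInertiaCoinvariants_eq_localPolynomialAt`, the tree's Euler-factor theorem,
Silverman *AEC* C.§16 / Serre–Tate Thm. 3); `V_ℓ(W_K) ≅ V_ℓ(W)|_{Γ_K}` and
`V_ℓ(W^{(D)}) ≅ V_ℓ(W) ⊗ χ_K` (`TateModuleGaloisTransportProofs`); the quadratic character `χ_K`,
the identification `res(Γ_K) = ker χ_K` and the Frobenius/inertia dictionary along `Γ_K → Γ_ℚ`
are `QuadraticBaseChangeGaloisProofs` (+ `inertia_le_range_absGaloisRestrict`,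
`FrobeniusPlaces`); and the three identities of characteristic polynomials on coinvariants are
`charpoly_toCoinvariants_twist`, `expand_two_reverse_charpoly_mul_self`,
`charpoly_toCoinvariants_inf_ker_eq_mul` (`GaloisRepresentations/CoinvariantsQuadraticTwist*`).
The assembly into `L`-series is the sibling `BSDQuadraticDescentProofs`.

## References

* K. Ireland, M. Rosen, *A Classical Introduction to Modern Number Theory*, 2nd ed., GTM 84
  (1990), Ch. 20 §5, Prop. 20.5.4(b) (PDF p. 353 of the held copy) and the definition of
  `L(E/K, s)` (PDF p. 350). [IrelandRosen1990]
* J.-P. Serre, *Facteurs locaux des fonctions zêta des variétés algébriques* (1970), §2.3, §4.1;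
  J. H. Silverman, *The Arithmetic of Elliptic Curves*, 2nd ed. (2009), §C.16. [SilvermanAEC2009]
-/

noncomputable section

open scoped Classical NumberField Pointwise
open Field IsDedekindDomain NumberField Polynomial

namespace WeierstrassCurve

open Literature.NumberTheory.EllipticCurves Literature.NumberTheory.GaloisRepresentations
  Literature.NumberTheory.QuadraticFields Literature.RepresentationTheory.Semisimple

/-- **A square root of the discriminant generating a quadratic field.**  For `[K : ℚ] = 2` there
is `θ ∈ K`, `θ ∉ ℚ`, with `θ² = d_K` (`K = ℚ(√d_K)`): a square-root generator `θ₀² = c`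
(`Quadratic.exists_sq_eq_algebraMap`) and `d_K = c q²` (`NumberField.exists_discr_eq_mul_sq`,
Marcus, *Number Fields*, Ch. 2).  [folklore] -/
theorem _root_.Literature.NumberTheory.EllipticCurves.exists_sq_eq_discr_not_mem_range
    (K : Type) [Field K] [NumberField K] (h2 : Module.finrank ℚ K = 2) :
    ∃ θ : K, θ ∉ Set.range (algebraMap ℚ K) ∧ θ ^ 2 = algebraMap ℚ K (NumberField.discr K : ℚ) := by
  obtain ⟨θ₀, c, hθ₀, hc⟩ := Quadratic.exists_sq_eq_algebraMap (F := ℚ) (K := K) h2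
  obtain ⟨q, hq, hD⟩ := NumberField.exists_discr_eq_mul_sq h2 hθ₀ hc
  refine ⟨algebraMap ℚ K q * θ₀, ?_, ?_⟩
  · rintro ⟨r, hr⟩
    apply hθ₀
    refine ⟨r / q, ?_⟩
    rw [map_div₀, hr, mul_div_cancel_left₀ _ ((map_ne_zero (algebraMap ℚ K)).mpr hq)]
  · rw [mul_pow, hc, ← map_pow, ← map_mul, hD, mul_comm]

variable (W : WeierstrassCurve ℚ) [W.IsElliptic] (K : Type) [Field K] [NumberField K]

set_option maxHeartbeats 1600000 in
/-- **Artin formalism for a quadratic base change, place by place** (Ireland–Rosen,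
Prop. 20.5.4(b), for Mathlib's local polynomials).  Let `W/ℚ` be an elliptic curve, `K` a
quadratic field, `D = d_K`, `W^{(D)} = W.quadraticTwist D`, `w ∣ v` finite places of `K` and `ℚ`,
and write `L_w = (W.baseChange K).localPolynomialAt w`, `L_v = W.localPolynomialAt v`,
`L_v^{(D)} = (W.quadraticTwist D).localPolynomialAt v`.  Then: (split) if `e(w|v) = f(w|v) = 1`,
`L_w = L_v` and `L_v^{(D)} = L_v`; (inert) if `e(w|v) = 1` and `f(w|v) = 2`,
`expand 2 L_w = L_v · L_v^{(D)}`; (ramified) if `w` is the only place of `K` above `v` and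
`f(w|v) = 1`, `L_w = L_v · L_v^{(D)}`.  These are the local identities behind
`L(E/K, s) = L(E/ℚ, s) · L(E_D/ℚ, s)` (loc. cit.: "it is not too hard to prove"), proved through
the `ℓ`-adic Tate module as explained in the module docstring.
[cite: IrelandRosen1990, Ch. 20 §5, Prop. 20.5.4(b) (PDF p. 353)] -/
theorem localPolynomialAt_baseChange_quadratic (h2 : Module.finrank ℚ K = 2)
    {v : HeightOneSpectrum (𝓞 ℚ)} {w : HeightOneSpectrum (𝓞 K)}
    (hw : w.asIdeal.under (𝓞 ℚ) = v.asIdeal) :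
    (w.asIdeal.ramificationIdx (𝓞 ℚ) = 1 → w.asIdeal.inertiaDeg (𝓞 ℚ) = 1 →
      (W.baseChange K).localPolynomialAt w = W.localPolynomialAt v ∧
        (W.quadraticTwist (NumberField.discr K : ℚ)).localPolynomialAt v =
          W.localPolynomialAt v) ∧
    (w.asIdeal.ramificationIdx (𝓞 ℚ) = 1 → w.asIdeal.inertiaDeg (𝓞 ℚ) = 2 →
      expand ℤ 2 ((W.baseChange K).localPolynomialAt w) =
        W.localPolynomialAt v * (W.quadraticTwist (NumberField.discr K : ℚ)).localPolynomialAt v) ∧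
    ((∀ w' : HeightOneSpectrum (𝓞 K), w'.asIdeal.under (𝓞 ℚ) = v.asIdeal → w' = w) →
      w.asIdeal.inertiaDeg (𝓞 ℚ) = 1 →
      (W.baseChange K).localPolynomialAt w =
        W.localPolynomialAt v * (W.quadraticTwist (NumberField.discr K : ℚ)).localPolynomialAt v) := by
  /- ### Setup: a prime `ℓ ∤ v`, the fields, the character, the Tate modules -/
  set D : ℚ := (NumberField.discr K : ℚ) with hDdef
  have hD0 : D ≠ 0 := by rw [hDdef]; exact_mod_cast NumberField.discr_ne_zero K
  haveI hEd : (W.quadraticTwist D).IsElliptic := W.isElliptic_quadraticTwist hD0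
  haveI hEK : (W.baseChange K).IsElliptic := by rw [baseChange]; infer_instance
  haveI : FiniteDimensional ℚ K := Module.finite_of_finrank_pos (by rw [h2]; exact two_pos)
  haveI : Algebra.IsQuadraticExtension ℚ K := ⟨h2⟩
  obtain ⟨ℓ, hℓp, hℓv⟩ := HeightOneSpectrum.exists_prime_natCast_not_mem v
  haveI : Fact ℓ.Prime := ⟨hℓp⟩
  have hℓw : (ℓ : 𝓞 K) ∉ w.asIdeal := by
    intro hmem
    apply hℓv
    have : (ℓ : 𝓞 K) = algebraMap (𝓞 ℚ) (𝓞 K) ℓ := by simp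
    rw [this] at hmem
    rw [← hw, Ideal.under_def, Ideal.mem_comap]
    exact hmem
  -- `θ ∈ K`, `θ² = D`, `θ ∉ ℚ`
  obtain ⟨θ, hθF, hθ⟩ := exists_sq_eq_discr_not_mem_range K h2
  -- the quadratic character `χ = χ_K : Γ_ℚ → ℚ_ℓˣ` and `H = res(Γ_K) = ker χ`
  obtain ⟨χ, hχ1, hχ2, hχpm⟩ := exists_quadraticCharacter (F := ℚ) hD0 ℚ_[ℓ]
  set H := (absGaloisRestrict ℚ K).range with hH
  have hHχ : ∀ γ : absoluteGaloisGroup K, χ (absGaloisRestrict ℚ K γ) = 1 := fun γ ↦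
    hχ1 _ (absGaloisRestrict_smul_geomSqrt hθ γ)
  have hm1 : (-1 : ℚ_[ℓ]ˣ) ≠ 1 := by
    intro h
    have h' : ((-1 : ℚ_[ℓ]ˣ) : ℚ_[ℓ]) = ((1 : ℚ_[ℓ]ˣ) : ℚ_[ℓ]) := by rw [h]
    rw [Units.val_neg, Units.val_one] at h'
    exact absurd h' (by norm_num)
  have hχH : ∀ σ : absoluteGaloisGroup ℚ, χ σ = 1 → σ ∈ H := by
    intro σ hσ
    rcases smul_geomSqrt_eq_or σ D with h | h
    · exact mem_range_absGaloisRestrict_of_smul_geomSqrt h2 hθF hθ h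
    · exact absurd ((hχ2 σ h).symm.trans hσ) hm1
  have hχne : ∀ σ : absoluteGaloisGroup ℚ, χ σ ≠ 1 → χ σ = -1 := fun σ h ↦
    (hχpm σ).resolve_left h
  -- the three `ℓ`-adic representations and the two comparison isomorphisms
  haveI := W.module_finite_rationalTateModule_holds ℓ
  haveI := (W.baseChange K).module_finite_rationalTateModule_holds ℓ
  haveI := (W.quadraticTwist D).module_finite_rationalTateModule_holds ℓ
  have hcW := W.continuous_rationalGaloisRepTate_holds ℓ
  have hcK := (W.baseChange K).continuous_rationalGaloisRepTate_holds ℓ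
  have hcd := (W.quadraticTwist D).continuous_rationalGaloisRepTate_holds ℓ
  set ρ := rationalTateGaloisRepOf (geomPoints W) ℓ hcW with hρ
  set ρK := rationalTateGaloisRepOf (geomPoints (W.baseChange K)) ℓ hcK with hρK
  set ρd := rationalTateGaloisRepOf (geomPoints (W.quadraticTwist D)) ℓ hcd with hρd
  obtain ⟨EK, hEK⟩ := W.exists_rationalTateModule_equiv_baseChange K ℓ
  obtain ⟨Ed, hEd⟩ := W.exists_rationalTateModule_equiv_quadraticTwist hD0 ℓ χ hχ1 hχ2
  /- ### The primes: `𝔔 ∣ w`, a Frobenius `Φ` of `K`, `𝔓 = ι⁻¹ 𝔔 ∣ v` -/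
  obtain ⟨𝔔, h𝔔⟩ := HeightOneSpectrum.primesAbove_nonempty w
  haveI : 𝔔.IsPrime := h𝔔.1
  obtain ⟨Φ, hΦ⟩ := HeightOneSpectrum.exists_isArithFrobAt_of_mem_primesAbove_holds h𝔔
  set 𝔓 := 𝔔.comap (absIntegersMap ℚ K) with h𝔓def
  have h𝔓 : 𝔓 ∈ v.primesAbove := comap_absIntegersMap_mem_primesAbove hw h𝔔
  haveI : 𝔓.IsPrime := h𝔓.1
  set DQ := 𝔔.decompositionSubgroup (absoluteGaloisGroup K) with hDQ
  set DP := 𝔓.decompositionSubgroup (absoluteGaloisGroup ℚ) with hDP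
  have hΦD : Φ ∈ DQ := hΦ.mem_stabilizer
  have hresD : ∀ γ : absoluteGaloisGroup K, γ ∈ DQ → absGaloisRestrict ℚ K γ ∈ DP := by
    intro γ hγ
    have h : γ ∈ DP.comap (absGaloisRestrict ℚ K).toMonoidHom := by
      rw [hDP, h𝔓def, comap_decompositionSubgroup_comap_absIntegersMap ℚ K 𝔔]
      exact hγ
    exact h
  -- the restriction `D_𝔔 → D_𝔓`
  set f : DQ →* DP := ((absGaloisRestrict ℚ K).toMonoidHom.comp DQ.subtype).codRestrict DP
    (fun γ ↦ hresD γ γ.2) with hfdef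
  have hfval : ∀ γ : DQ, ((f γ : DP) : absoluteGaloisGroup ℚ) = absGaloisRestrict ℚ K γ :=
    fun _ ↦ rfl
  -- the representations of the decomposition groups on `V = V_ℓ(W)`
  set ID : Subgroup DP := 𝔓.inertia DP with hID
  haveI : ID.Normal := inferInstanceAs (𝔓.inertia DP).Normal
  set χD : DP →* ℚ_[ℓ]ˣ := χ.comp DP.subtype with hχD
  set ρD : Representation ℚ_[ℓ] DP (W.rationalTateModule ℓ) := ρ.toRepresentation.comp DP.subtype
    with hρD
  have hmemID : ∀ x : DP, x ∈ ID ↔ (x : absoluteGaloisGroup ℚ) ∈ 𝔓.inertia (absoluteGaloisGroup ℚ) :=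
    fun x ↦ Iff.rfl
  have hmemIQ : ∀ y : DQ, y ∈ 𝔔.inertia DQ ↔ (y : absoluteGaloisGroup K) ∈ 𝔔.inertia (absoluteGaloisGroup K) :=
    fun y ↦ Iff.rfl
  /- ### Euler factors as characteristic polynomials (the tree's theorem, for all pairs) -/
  have hinjmap : Function.Injective (Polynomial.map (Int.castRingHom ℚ_[ℓ])) :=
    Polynomial.map_injective _ (RingHom.injective_int _)
  -- `L_v(W)` at any Frobenius `σ ∈ D_𝔓`
  have hP : ∀ (σ : DP), IsArithFrobAt (𝓞 ℚ) (σ : absoluteGaloisGroup ℚ) 𝔓 →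
      (ρD.toCoinvariants ID σ).charpoly.reverse =
        (W.localPolynomialAt v).map (Int.castRingHom ℚ_[ℓ]) := fun σ hσ ↦
    W.reverse_charpoly_toInertiaCoinvariants_eq_localPolynomialAt ℓ hcW hℓv h𝔓 σ hσ
  -- `L_v(W^{(D)})` at any Frobenius, transported to the twist of `ρD`
  have hPd : ∀ (σ : DP), IsArithFrobAt (𝓞 ℚ) (σ : absoluteGaloisGroup ℚ) 𝔓 →
      ((Literature.RepresentationTheory.Semisimple.Representation.twist ρD χD).toCoinvariants ID σ).charpoly.reverse =
        ((W.quadraticTwist D).localPolynomialAt v).map (Int.castRingHom ℚ_[ℓ]) := by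
    intro σ hσ
    rw [← (W.quadraticTwist D).reverse_charpoly_toInertiaCoinvariants_eq_localPolynomialAt ℓ hcd
      hℓv h𝔓 σ hσ]
    congr 1
    symm
    refine charpoly_toCoinvariants_eq_of_equiv (Literature.RepresentationTheory.Semisimple.Representation.twist ρD χD)
      (ρd.toRepresentation.comp DP.subtype) (MonoidHom.id DP) Ed (fun g x ↦ ?_) ID ID
      (by rw [Subgroup.map_id]) σ
    change Ed ((W.quadraticTwist D).rationalGaloisRepTate ℓ (g : absoluteGaloisGroup ℚ) x) =
      (χ (g : absoluteGaloisGroup ℚ) : ℚ_[ℓ]) •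
        W.rationalGaloisRepTate ℓ (g : absoluteGaloisGroup ℚ) (Ed x)
    exact hEd _ x
  -- `L_w(W_K)` at `Φ`, transported to `ρD` on the coinvariants for `I_𝔓 ∩ ker χ`
  have hS : ID ⊓ χD.ker = (𝔔.inertia DQ).map f := by
    ext x
    rw [Subgroup.mem_inf, MonoidHom.mem_ker, Subgroup.mem_map]
    constructor
    · rintro ⟨hxI, hxχ⟩
      change χ (x : absoluteGaloisGroup ℚ) = 1 at hxχ
      obtain ⟨γ₀, hγ₀⟩ := hχH _ hxχ
      have hγ₀I : γ₀ ∈ 𝔔.inertia (absoluteGaloisGroup K) := by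
        rw [← comap_inertia_comap_absIntegersMap ℚ K 𝔔, Subgroup.mem_comap, hγ₀]
        exact hxI
      refine ⟨⟨γ₀, Ideal.inertia_le_decompositionSubgroup _ _ hγ₀I⟩, hγ₀I, Subtype.ext ?_⟩
      rw [hfval]
      exact hγ₀
    · rintro ⟨γ, hγ, rfl⟩
      refine ⟨?_, hHχ _⟩
      rw [hmemID, hfval]
      exact absGaloisRestrict_mem_inertia_comap ℚ K ((hmemIQ γ).mp hγ)
  have hQ : (ρD.toCoinvariants (ID ⊓ χD.ker) (f ⟨Φ, hΦD⟩)).charpoly.reverse =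
      ((W.baseChange K).localPolynomialAt w).map (Int.castRingHom ℚ_[ℓ]) := by
    rw [← (W.baseChange K).reverse_charpoly_toInertiaCoinvariants_eq_localPolynomialAt ℓ hcK hℓw
      h𝔔 ⟨Φ, hΦD⟩ hΦ]
    congr 1
    symm
    refine charpoly_toCoinvariants_eq_of_equiv ρD (ρK.toRepresentation.comp DQ.subtype) f EK.symm
      (fun g x ↦ ?_) (ID ⊓ χD.ker) (𝔔.inertia DQ) hS ⟨Φ, hΦD⟩
    apply EK.injective
    rw [LinearEquiv.apply_symm_apply]
    change (W.baseChange K).rationalGaloisRepTate ℓ (g : absoluteGaloisGroup K) x =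
      EK (W.rationalGaloisRepTate ℓ (absGaloisRestrict ℚ K g) (EK.symm x))
    rw [hEK, LinearEquiv.apply_symm_apply]
  /- ### The three cases -/
  have hI_of_e : w.asIdeal.ramificationIdx (𝓞 ℚ) = 1 →
      𝔓.inertia (absoluteGaloisGroup ℚ) ≤ H := by
    intro he
    have he' : v.asIdeal.ramificationIdxIn (𝓞 K) = 1 := by
      haveI : w.asIdeal.IsPrime := w.isPrime
      haveI : v.asIdeal.IsMaximal := v.isMaximal
      haveI : w.asIdeal.LiesOver v.asIdeal := ⟨hw.symm⟩
      haveI : IsGaloisGroup (K ≃ₐ[ℚ] K) (𝓞 ℚ) (𝓞 K) := IsGaloisGroup.of_isFractionRing _ _ _ ℚ K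
      rw [Ideal.ramificationIdxIn_eq_ramificationIdx v.asIdeal w.asIdeal (K ≃ₐ[ℚ] K), he]
    exact inertia_le_range_absGaloisRestrict ℚ K he' h𝔓
  have hIDχ_of_e : w.asIdeal.ramificationIdx (𝓞 ℚ) = 1 → ∀ j ∈ ID, χD j = 1 := by
    intro he j hj
    obtain ⟨γ, hγ⟩ := hI_of_e he ((hmemID j).mp hj)
    change χ (j : absoluteGaloisGroup ℚ) = 1
    rw [← hγ]
    exact hHχ γ
  refine ⟨fun he hf ↦ ?_, fun he hf ↦ ?_, fun huniq hf ↦ ?_⟩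
  · /- **split**: `res Φ` is a Frobenius at `𝔓`, in `H`, and `I_𝔓 ≤ H = ker χ` -/
    have hIχ := hIDχ_of_e he
    have hφ : IsArithFrobAt (𝓞 ℚ) (absGaloisRestrict ℚ K Φ) 𝔓 :=
      isArithFrobAt_absGaloisRestrict_of_inertiaDeg_eq_one hw h𝔔 hΦ hf
    have hinf : ID ⊓ χD.ker = ID := inf_eq_left.mpr fun j hj ↦ hIχ j hj
    have h1 : (W.baseChange K).localPolynomialAt w = W.localPolynomialAt v := by
      apply hinjmap
      rw [← hQ, charpoly_toCoinvariants_congr ρD hinf, hP (f ⟨Φ, hΦD⟩) hφ]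
    refine ⟨h1, ?_⟩
    apply hinjmap
    rw [← hPd (f ⟨Φ, hΦD⟩) hφ, charpoly_toCoinvariants_twist ρD χD ID hIχ]
    have hχΦ : (χD (f ⟨Φ, hΦD⟩) : ℚ_[ℓ]) = 1 := by
      change (χ (absGaloisRestrict ℚ K Φ) : ℚ_[ℓ]) = 1
      rw [hHχ, Units.val_one]
    rw [hχΦ, one_smul, hP (f ⟨Φ, hΦD⟩) hφ]
  · /- **inert**: `res Φ ≡ φ² (mod I_𝔓)`, `χ(φ) = -1`, and `det(1 - F²T²) = det(1 - FT)det(1 + FT)` -/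
    have hIχ := hIDχ_of_e he
    have hinf : ID ⊓ χD.ker = ID := inf_eq_left.mpr fun j hj ↦ hIχ j hj
    obtain ⟨φ, hφ⟩ := HeightOneSpectrum.exists_isArithFrobAt_of_mem_primesAbove_holds h𝔓
    have hφD : φ ∈ DP := hφ.mem_stabilizer
    have hrel : absGaloisRestrict ℚ K Φ * (φ ^ 2)⁻¹ ∈ 𝔓.inertia (absoluteGaloisGroup ℚ) := by
      have h := absGaloisRestrict_mul_pow_inv_mem_inertia hw h𝔔 hΦ hφ
      rwa [hf] at h
    have hrel' : f ⟨Φ, hΦD⟩ * ((⟨φ, hφD⟩ : DP) ^ 2)⁻¹ ∈ ID := by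
      rw [hmemID]
      exact hrel
    -- `φ ∉ H` (a Frobenius in `H` would force `f = 1`), so `χ φ = -1`
    have hχφ : χ φ = -1 := by
      refine hχne φ fun h1 ↦ ?_
      obtain ⟨τ, hτ⟩ := hχH φ h1
      have hτ' : absGaloisRestrict ℚ K τ = φ := hτ
      have hf1 := inertiaDeg_eq_one_of_isArithFrobAt_absGaloisRestrict (F := ℚ) hw h𝔔 (τ := τ)
        (by rw [hτ']; exact hφ)
      rw [hf] at hf1
      exact absurd hf1 (by norm_num)
    set F : Module.End ℚ_[ℓ] (Representation.Coinvariants (ρD.comp ID.subtype)) :=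
      ρD.toCoinvariants ID ⟨φ, hφD⟩ with hFdef
    have hQ' : ((W.baseChange K).localPolynomialAt w).map (Int.castRingHom ℚ_[ℓ]) =
        (F * F).charpoly.reverse := by
      rw [← hQ, charpoly_toCoinvariants_congr ρD hinf, toCoinvariants_eq_of_mul_inv_mem ρD ID hrel',
        map_pow, sq]
    have hPφ : F.charpoly.reverse = (W.localPolynomialAt v).map (Int.castRingHom ℚ_[ℓ]) :=
      hP ⟨φ, hφD⟩ hφ
    have hPdφ : (-F).charpoly.reverse =
        ((W.quadraticTwist D).localPolynomialAt v).map (Int.castRingHom ℚ_[ℓ]) := by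
      rw [← hPd ⟨φ, hφD⟩ hφ, charpoly_toCoinvariants_twist ρD χD ID hIχ]
      have hval : (χD ⟨φ, hφD⟩ : ℚ_[ℓ]) = -1 := by
        change (χ φ : ℚ_[ℓ]) = -1
        rw [hχφ, Units.val_neg, Units.val_one]
      rw [hval, neg_smul, one_smul]
    apply hinjmap
    rw [Polynomial.map_expand, Polynomial.map_mul, hQ', expand_two_reverse_charpoly_mul_self F, hPφ,
      hPdφ]
  · /- **ramified**: `τ ∈ I_𝔓 ∖ H` has `χ(τ) = -1`; the coinvariants for `I_𝔓 ∩ Γ_K` split -/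
    have hHi : H.index = 2 := by rw [hH, index_range_absGaloisRestrict_eq_finrank, h2]
    have hHne : H ≠ ⊤ := fun htop ↦ by
      rw [htop, Subgroup.index_top] at hHi
      exact absurd hHi (by norm_num)
    obtain ⟨τ, hτI, hτH⟩ := exists_mem_inertia_not_mem_range hw huniq h𝔔 hf hHne
    have hτD : τ ∈ DP := Ideal.inertia_le_decompositionSubgroup _ _ hτI
    have hχτ : χD ⟨τ, hτD⟩ = -1 := hχne τ fun h1 ↦ hτH (hχH τ h1)
    have hτID : (⟨τ, hτD⟩ : DP) ∈ ID := (hmemID _).mpr hτI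
    have hφ : IsArithFrobAt (𝓞 ℚ) (absGaloisRestrict ℚ K Φ) 𝔓 :=
      isArithFrobAt_absGaloisRestrict_of_inertiaDeg_eq_one hw h𝔔 hΦ hf
    have hχΦ : χD (f ⟨Φ, hΦD⟩) = 1 := hHχ Φ
    have hχI : ∀ i ∈ ID, χD i = 1 ∨ χD i = -1 := fun i _ ↦ hχpm _
    have h2ℓ : (2 : ℚ_[ℓ]) ≠ 0 := two_ne_zero
    have key := charpoly_toCoinvariants_inf_ker_eq_mul h2ℓ ρD ID χD hχI hτID hχτ hχΦ
    apply hinjmap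
    rw [Polynomial.map_mul, ← hQ, key, Polynomial.reverse_mul_of_domain, hP (f ⟨Φ, hΦD⟩) hφ,
      hPd (f ⟨Φ, hΦD⟩) hφ]

end WeierstrassCurve
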